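import Literature.MathematicalPhysics.QuantumFieldTheory.Balaban1983to89.T4DatumAssemblyTowerReviseAE
import Literature.MathematicalPhysics.QuantumFieldTheory.Balaban1983to89.Node00.Record13SepCoPHV

/-!
# BalabanUVNodes ∕ N13 — THE K1⁹ (B)-SLOT SUPPLIER JUNCTION (repair road (δ), version-slot spelling (δⱽ): director-ym №210, plan g84 WORD-3b, DEF-1's `Node00/Record13SepCoPHV` p620607):
# Theorem 1's clause + [III] Cor. 3 (2.50) POINTWISE AT LEVEL 0 and `dV_k`-A.E. AT LEVELS `1 ≤ k ≤ K` on the γ-window at NODE 00's Stage-13 record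
# ⟹ `∃ v : Node00.Revision₁₃ F 2 θ h, B16.EndStatementBPrinted (Node00.datumOfRecord₁₃SepCoPHV F 2 θ h v).C` — B16's POINTWISE letter verbatim at a revised datum

Cell `pub-ymgap` (HUMAN RULING D-0062 Track A ∕ D-0149 width), WIDTH SEAT `pub-ymgap-dag-n13-w1` (gen 5, CLAIM-3a), key K1⁸ `StabilityBRunRowsAtRecordR13SepCoPH` = stmt-QuantumFields-26907
(`--kind proof --supports … --as helper`; count-neutral).  ROUTE-FREE (imports two Literature files only), so that every N13 ∕ K1 supplier seat can import it without the Theses cone.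
A composition of this seat's p620313 `T4DatumAssemblyTowerReviseAE.exists_tower_endStatementBPrinted_of_ae` (the re-chosen tower) with DEF-1's p620607 adapter
`Node00.exists_revision₁₃_of_exists_tower` (its guarded a.e. field fed by the unguarded conclusion); the upper exponent is enlarged to `max ep (−em)` internally
(`compat_at_record_max`: `χ^{(2.9)} ≤ 1`, `A^η ≥ 0`), so NO sign hypothesis is displayed.
[III] = [Balaban1988Convergent], [B16] = [Balaban1989LargeFieldII].

WHAT.  ★★★ `exists_revision₁₃_endStatementBPrinted_of_ae` (hypotheses `h1` = `B16.Thm1Printed (datumOfRecord₁₃SepCoPH F 2 θ h).C`; `h0` = (2.50) with `em ep` at EVERY field of level 0 on the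
γ-windowed runs; `hae` = (2.50) for `dV_{k+1}`-ALMOST EVERY field at levels `k+1 ≤ K` on the γ-windowed runs) and its bundled form `exists_revision₁₃_endStatementBPrinted_of_aeDisplay` (the
№210-letter display «Thm1 ∧ ∃ γ em ep, pointwise@0 ∧ a.e.@≥1» ⟹ the slot display).  What remains CONTENT: `h1` (Theorem 1's clause at the record), `h0` (level 0 — this lineage's g0 p586609 ∕ p590719 modulo a
β-floor letter), `hae` ([III] Cor. 3 proper at levels ≥ 1, version-free currency — the N13 suppliers: dag-n13-w2 g4 p619268 ∕ INTENT-3′, dag-n13-w3 g4's measure road).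

HONEST FRAMING.  Count-neutral by-name junction; nothing of Bałaban's asserted or refuted; (2.50) NOT proved in any currency; K1⁸ ∕ the pending K1⁹ NEITHER proved NOR refuted; N13 NOT
discharged; no stub closed; counts unmoved (typed 28∕28 · discharged 5∕27, A 5∕28); one finite `𝕋⁴_{L^K}` programme at fixed ε; R4 closes the CONDITIONAL finite-𝕋⁴ rung `BalabanLadder.UV`
only — the Yang–Mills mass gap (Clay) is NOT proved by any of this.  No `sorry`, `def`, `instance`, `notation`; standard axioms.
-/

noncomputable section

open scoped BigOperators ENNReal NNReal Matrix.Norms.L2Operator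

namespace Summit.QuantumFields.YangMills.BalabanUVNodes.K1R9VersionSlotOfAEAtRecord

open MeasureTheory
open Literature.MathematicalPhysics.QuantumFieldTheory.Balaban1983to89
open Literature.MathematicalPhysics.QuantumFieldTheory.Balaban1983to89.T4Continuum (T4Family FiniteEpsData)
open Literature.MathematicalPhysics.QuantumFieldTheory.Balaban1983to89.Node00
open Literature.MathematicalPhysics.QuantumFieldTheory.Balaban1983to89.T4DatumAssembly.TowerReviseAE
  (exists_tower_endStatementBPrinted_of_ae uvIneq_mono_upper compat_at_record_max)

variable {F : T4Family}

open Classical in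
/-- **★★★ THE K1⁹ (B)-SLOT SUPPLIER JUNCTION**: at `(θ, h)`, Theorem 1's clause for the record datum + (2.50) with SOME `em ep` on the `γ`-windowed runs POINTWISE at level 0
and `dV_k`-A.E. at levels `1 ≤ k ≤ K` (NO sign hypothesis) ⟹ `∃ v : Node00.Revision₁₃ F 2 θ h, B16.EndStatementBPrinted (Node00.datumOfRecord₁₃SepCoPHV F 2 θ h v).C` — B16's
POINTWISE letter verbatim at a revised datum.  PROOF: this seat's `TowerReviseAE.exists_tower_endStatementBPrinted_of_ae` at the core ∕ tower of record with the upper exponent enlarged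
to `max ep (−em)` (`compat_at_record_max`), then DEF-1's adapter `Node00.exists_revision₁₃_of_exists_tower` (its guarded a.e. field fed by `fun p k _ => hae p k`).
[cite: Balaban1989LargeFieldII, Thm 1 + (0.1) pp.355–356; Balaban1988Convergent, Cor. 3 (2.50) p.264, (0.2) p.244 (bookkeeping; a composition of the two landed files)] -/
theorem exists_revision₁₃_endStatementBPrinted_of_ae (θ : Stage13HParams F 2) (h : θ.Provisos₁₃SepCoPH F 2) {γ : ℝ} (hγ : 0 < γ) (em ep : ℝ → ℝ)
    (h1 : B16.Thm1Printed (datumOfRecord₁₃SepCoPH F 2 θ h).C)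
    (h0 : ∀ p : B12.RunParams, ((datumOfRecord₁₃SepCoPH F 2 θ h).C p).flow.InInterval γ p.K →
      ∀ V : GaugeField (F.P p.K) 0 (SU 2),
        B16.UVIneq ((datumOfRecord₁₃SepCoPH F 2 θ h).C p) 0 V (em (((datumOfRecord₁₃SepCoPH F 2 θ h).C p).flow.g 0))
          (ep (((datumOfRecord₁₃SepCoPH F 2 θ h).C p).flow.g 0)))
    (hae : ∀ p : B12.RunParams, ((datumOfRecord₁₃SepCoPH F 2 θ h).C p).flow.InInterval γ p.K → ∀ k : ℕ, k + 1 ≤ p.K →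
      ∀ᵐ V ∂fieldMeasure (F.P p.K) (k + 1) (SU 2),
        B16.UVIneq ((datumOfRecord₁₃SepCoPH F 2 θ h).C p) (k + 1) V (em (((datumOfRecord₁₃SepCoPH F 2 θ h).C p).flow.g (k + 1)))
          (ep (((datumOfRecord₁₃SepCoPH F 2 θ h).C p).flow.g (k + 1)))) :
    ∃ v : Revision₁₃ F 2 θ h, B16.EndStatementBPrinted (datumOfRecord₁₃SepCoPHV F 2 θ h v).C := by
  have hle : ∀ g, ep g ≤ (fun g => max (ep g) (-em g)) g := fun g => le_max_left _ _
  obtain ⟨τ', hρ0, hρae, _hT, hB⟩ :=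
    exists_tower_endStatementBPrinted_of_ae (coreOfRecord₁₃CoPH F 2 θ) (towerOfRecord₁₃SepCoPH F 2 θ h) hγ em (fun g => max (ep g) (-em g)) h1
      (fun p hp V => uvIneq_mono_upper (h0 p hp V) (hle _))
      (fun p hp k hk => by
        filter_upwards [hae p hp k hk] with V hV
        exact uvIneq_mono_upper hV (hle _))
      (fun p _ k _ V => compat_at_record_max θ em ep p k V)
  exact exists_revision₁₃_of_exists_tower F 2 θ h B16.EndStatementBPrinted ⟨τ', hρ0, fun p k _ => hρae p k, hB⟩

/-- **THE №210-LETTER (B)ᴬᴱ DISPLAY IMPLIES THE (δⱽ) (B)-SLOT DISPLAY** (the two (δ)-internal spellings of plan g84 ■ CLOSE ∕ WORD-3b, K1 side): from «Theorem 1's clause ∧ ∃ γ em ep,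
(2.50) pointwise@0 ∧ a.e.@≥1 on the window» to «∃ v, (B) AS TYPED at `datumOfRecord₁₃SepCoPHV θ h v`». [cite: Balaban1989LargeFieldII, Thm 1 + (0.1) pp.355–356; Balaban1988Convergent, Cor. 3 (2.50) p.264 (bookkeeping)] -/
theorem exists_revision₁₃_endStatementBPrinted_of_aeDisplay (θ : Stage13HParams F 2) (h : θ.Provisos₁₃SepCoPH F 2)
    (hAE : B16.Thm1Printed (datumOfRecord₁₃SepCoPH F 2 θ h).C ∧
      ∃ γ : ℝ, 0 < γ ∧ ∃ em ep : ℝ → ℝ,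
        (∀ p : B12.RunParams, ((datumOfRecord₁₃SepCoPH F 2 θ h).C p).flow.InInterval γ p.K →
          ∀ V : GaugeField (F.P p.K) 0 (SU 2),
            B16.UVIneq ((datumOfRecord₁₃SepCoPH F 2 θ h).C p) 0 V (em (((datumOfRecord₁₃SepCoPH F 2 θ h).C p).flow.g 0))
              (ep (((datumOfRecord₁₃SepCoPH F 2 θ h).C p).flow.g 0))) ∧
        (∀ p : B12.RunParams, ((datumOfRecord₁₃SepCoPH F 2 θ h).C p).flow.InInterval γ p.K → ∀ k : ℕ, k + 1 ≤ p.K →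
          ∀ᵐ V ∂fieldMeasure (F.P p.K) (k + 1) (SU 2),
            B16.UVIneq ((datumOfRecord₁₃SepCoPH F 2 θ h).C p) (k + 1) V (em (((datumOfRecord₁₃SepCoPH F 2 θ h).C p).flow.g (k + 1)))
              (ep (((datumOfRecord₁₃SepCoPH F 2 θ h).C p).flow.g (k + 1))))) :
    ∃ v : Revision₁₃ F 2 θ h, B16.EndStatementBPrinted (datumOfRecord₁₃SepCoPHV F 2 θ h v).C := by
  obtain ⟨h1, γ, hγ, em, ep, h0, hae⟩ := hAE
  exact exists_revision₁₃_endStatementBPrinted_of_ae θ h hγ em ep h1 h0 hae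

end Summit.QuantumFields.YangMills.BalabanUVNodes.K1R9VersionSlotOfAEAtRecord

end
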